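import Summits.AnomalousDissipation.AnomalousDissipation.Theorems.QuarticGate.Negative.LevelCeiling
import Literature.Analysis.FluidPDE.BeltramiWavesCurl
import Literature.Analysis.FunctionSpaces.TorusHolderSobolevEmbedding

/-!
# Shear translations on the torus: pointwise calculus

Helper file for stub S6′ (`stub_order2DesignSym`) of the line `axis-sectors` of crux
`MomentParity.QuarticGate`. The symmetric order-2 design is obtained from an order-2 design by
AVERAGING its law over the finite shear group `H_L = {a : T³ | a 1 = 0, L • a = 0}` acting by
translations `u ↦ u(· + a)`. This file records the purely pointwise bookkeeping of translations
`g ↦ g(· + a)` on `T³`: they commute with `Torus.fderiv`, `Torus.partialDeriv`, `Torus.laplacian`,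
`BDSV.curl`, the Fourier truncation `P_N`, preserve divergence-freeness, zero mean, the band-test
property, the level property and the spectral enstrophy `‖∇·‖²`, and change `L²` pairings by the
inverse translation of the test field.
-/

namespace Summit.AnomalousDissipation.AnomalousDissipation.Theorems.MomentParityQuarticGate

open MeasureTheory Filter
open scoped InnerProductSpace RealInnerProductSpace ENNReal
open Literature.Analysis.FunctionSpaces Literature.Analysis.FluidPDE
open Summit.AnomalousDissipation.AnomalousDissipation.Theorems.QuarticGate.Negative

set_option linter.dupNamespace false

noncomputable section

section Calculus

variable {F : Type*}

/-- The re-centred lift of a translate is the re-centred lift at the translated point. [folklore] -/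
theorem liftAt_comp_add_right (g : UnitAddTorus (Fin 3) → F) (a x : UnitAddTorus (Fin 3)) :
    Torus.liftAt (fun y => g (y + a)) x = Torus.liftAt g (x + a) := by
  funext v
  simp only [Torus.liftAt_apply]
  rw [add_right_comm]

variable [NormedAddCommGroup F] [NormedSpace ℝ F]

/-- **Translations commute with the Fréchet derivative**: `D(g(· + a))(x) = Dg(x + a)`. [folklore] -/
theorem fderiv_comp_add_right (g : UnitAddTorus (Fin 3) → F) (a x : UnitAddTorus (Fin 3)) :
    Torus.fderiv (fun y => g (y + a)) x = Torus.fderiv g (x + a) := by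
  unfold Torus.fderiv
  rw [liftAt_comp_add_right]

/-- Translations commute with directional derivatives. [folklore] -/
theorem lineDeriv_comp_add_right (g : UnitAddTorus (Fin 3) → F) (a x : UnitAddTorus (Fin 3))
    (v : EuclideanSpace ℝ (Fin 3)) :
    Torus.lineDeriv (fun y => g (y + a)) x v = Torus.lineDeriv g (x + a) v := by
  unfold Torus.lineDeriv
  simp_rw [add_right_comm _ _ a]

/-- Translations commute with partial derivatives. [folklore] -/
theorem partialDeriv_comp_add_right (i : Fin 3) (g : UnitAddTorus (Fin 3) → F) (a x : UnitAddTorus (Fin 3)) :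
    Torus.partialDeriv i (fun y => g (y + a)) x = Torus.partialDeriv i g (x + a) :=
  lineDeriv_comp_add_right g a x _

/-- Translations commute with the Laplacian. [folklore] -/
theorem laplacian_comp_add_right (g : UnitAddTorus (Fin 3) → F) (a x : UnitAddTorus (Fin 3)) :
    Torus.laplacian (fun y => g (y + a)) x = Torus.laplacian g (x + a) := by
  unfold Torus.laplacian
  rw [liftAt_comp_add_right]

/-- Translations commute with the Laplacian (function form). [folklore] -/
theorem laplacian_comp_add_right' (g : UnitAddTorus (Fin 3) → F) (a : UnitAddTorus (Fin 3)) :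
    Torus.laplacian (fun y => g (y + a)) = fun x => Torus.laplacian g (x + a) :=
  funext fun x => laplacian_comp_add_right g a x

end Calculus

/-- Translations commute with the divergence. [folklore] -/
theorem divergence_comp_add_right (g : UnitAddTorus (Fin 3) → EuclideanSpace ℝ (Fin 3))
    (a x : UnitAddTorus (Fin 3)) :
    Torus.divergence (fun y => g (y + a)) x = Torus.divergence g (x + a) := by
  unfold Torus.divergence
  exact Finset.sum_congr rfl fun i _ => partialDeriv_comp_add_right i (fun y => g y i) a x

/-- **Translates of divergence-free fields are divergence free.** [folklore] -/
theorem isDivFree_comp_add_right {g : UnitAddTorus (Fin 3) → EuclideanSpace ℝ (Fin 3)}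
    (hg : Torus.IsDivFree g) (a : UnitAddTorus (Fin 3)) : Torus.IsDivFree fun y => g (y + a) :=
  fun x => by rw [divergence_comp_add_right, hg]

/-- **Translates of mean-zero fields have zero mean** (translation invariance of the Haar
measure). [folklore] -/
theorem hasZeroMean_comp_add_right {F : Type*} [NormedAddCommGroup F] [NormedSpace ℝ F]
    {g : UnitAddTorus (Fin 3) → F} (hg : Torus.HasZeroMean g) (a : UnitAddTorus (Fin 3)) :
    Torus.HasZeroMean fun y => g (y + a) := by
  unfold Torus.HasZeroMean at hg ⊢
  rw [integral_add_right_eq_self g a, hg]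

/-- Translations commute with the curl. [folklore] -/
theorem curl_comp_add_right (g : UnitAddTorus (Fin 3) → EuclideanSpace ℝ (Fin 3))
    (a x : UnitAddTorus (Fin 3)) :
    BDSV.curl (fun y => g (y + a)) x = BDSV.curl g (x + a) := by
  simp only [BDSV.curl, partialDeriv_comp_add_right]

/-- Translations commute with the curl (function form). [folklore] -/
theorem curl_comp_add_right' (g : UnitAddTorus (Fin 3) → EuclideanSpace ℝ (Fin 3))
    (a : UnitAddTorus (Fin 3)) :
    BDSV.curl (fun y => g (y + a)) = fun x => BDSV.curl g (x + a) :=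
  funext fun x => curl_comp_add_right g a x

/-- Translating forth and back is the identity: `(g(· + a))(· - a) = g`. [folklore] -/
theorem comp_add_right_comp_sub_right {β : Type*} (g : UnitAddTorus (Fin 3) → β) (a : UnitAddTorus (Fin 3)) :
    (fun x => (fun y => g (y + a)) (x - a)) = g := by
  funext x
  simp only [sub_add_cancel]

/-- Translating back and forth is the identity: `(g(· - a))(· + a) = g`. [folklore] -/
theorem comp_sub_right_comp_add_right {β : Type*} (g : UnitAddTorus (Fin 3) → β) (a : UnitAddTorus (Fin 3)) :
    (fun x => (fun y => g (y - a)) (x + a)) = g := by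
  funext x
  simp only [add_sub_cancel_right]

/-! ## Fourier side -/

/-- **Fourier coefficients of the complexified translate**: `𝓕(g(· + a))(k) = e_k(a) • ĝ(k)`.
[folklore] -/
theorem mFourierCoeff_complexify_comp_add_right (g : UnitAddTorus (Fin 3) → EuclideanSpace ℝ (Fin 3))
    (a : UnitAddTorus (Fin 3)) (k : Fin 3 → ℤ) :
    UnitAddTorus.mFourierCoeff (EuclideanSpace.complexify ∘ fun y => g (y + a)) k =
      (UnitAddTorus.mFourier k a : ℂ) • UnitAddTorus.mFourierCoeff (EuclideanSpace.complexify ∘ g) k :=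
  Torus.mFourierCoeff_comp_add_right (EuclideanSpace.complexify ∘ g) a k

/-- The characters do not vanish. [folklore] -/
theorem mFourier_apply_ne_zero (k : Fin 3 → ℤ) (a : UnitAddTorus (Fin 3)) :
    (UnitAddTorus.mFourier k a : ℂ) ≠ 0 := by
  intro h
  have h1 : ‖(UnitAddTorus.mFourier k a : ℂ)‖ = 1 := by simp [UnitAddTorus.mFourier]
  rw [h, norm_zero] at h1
  exact zero_ne_one h1

/-- **Translation preserves the frequency support**: the coefficients of `g(· + a)` vanish off a
set iff those of `g` do. [folklore] -/
theorem mFourierCoeff_comp_add_right_eq_zero_iff (g : UnitAddTorus (Fin 3) → EuclideanSpace ℝ (Fin 3))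
    (a : UnitAddTorus (Fin 3)) (k : Fin 3 → ℤ) :
    UnitAddTorus.mFourierCoeff (EuclideanSpace.complexify ∘ fun y => g (y + a)) k = 0 ↔
      UnitAddTorus.mFourierCoeff (EuclideanSpace.complexify ∘ g) k = 0 := by
  rw [mFourierCoeff_complexify_comp_add_right, smul_eq_zero, or_iff_right (mFourier_apply_ne_zero k a)]

/-- **Translates of band tests are band tests.** [folklore] -/
theorem isBandTest_comp_add_right {N : ℕ} {g : UnitAddTorus (Fin 3) → EuclideanSpace ℝ (Fin 3)}
    (hg : IsBandTest N g) (a : UnitAddTorus (Fin 3)) : IsBandTest N fun y => g (y + a) :=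
  ⟨hg.1.comp_add_right a, isDivFree_comp_add_right hg.2.1 a, hasZeroMean_comp_add_right hg.2.2.1 a,
    fun k hk => (mFourierCoeff_comp_add_right_eq_zero_iff g a k).2 (hg.2.2.2 k hk)⟩

/-- Translating a vector trigonometric polynomial multiplies its coefficients by characters.
[folklore] -/
theorem trigPoly_comp_add_right (S : Finset (Fin 3 → ℤ)) (c : (Fin 3 → ℤ) → EuclideanSpace ℂ (Fin 3))
    (a x : UnitAddTorus (Fin 3)) :
    Torus.trigPoly S c (x + a) = Torus.trigPoly S (fun k => (UnitAddTorus.mFourier k a : ℂ) • c k) x := by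
  simp only [Torus.trigPoly_apply, Torus.mFourier_apply_add, smul_smul]

/-- **Translations commute with the Fourier truncation**: `P_N (u(· + a)) = (P_N u)(· + a)`.
[folklore] -/
theorem fourierTruncate_comp_add_right (N : ℕ) (u : UnitAddTorus (Fin 3) → EuclideanSpace ℝ (Fin 3))
    (a : UnitAddTorus (Fin 3)) :
    Torus.fourierTruncate N (fun y => u (y + a)) = fun x => Torus.fourierTruncate N u (x + a) := by
  funext x
  rw [Torus.fourierTruncate_eq, Torus.fourierTruncate_eq, Torus.realTrigPoly_apply,
    Torus.realTrigPoly_apply, trigPoly_comp_add_right]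
  simp_rw [mFourierCoeff_complexify_comp_add_right]

/-- **The Fourier truncation only sees the `L²` class**: a.e.-equal fields have the same
truncation. [folklore] -/
theorem fourierTruncate_congr_ae {N : ℕ} {u v : UnitAddTorus (Fin 3) → EuclideanSpace ℝ (Fin 3)}
    (h : u =ᵐ[volume] v) : Torus.fourierTruncate N u = Torus.fourierTruncate N v := by
  rw [Torus.fourierTruncate_eq, Torus.fourierTruncate_eq]
  simp_rw [Torus.mFourierCoeff_congr_ae (h.fun_comp EuclideanSpace.complexify)]

/-- **Translation preserves the spectral enstrophy**: `‖∇(u(· + a))‖² = ‖∇u‖²`. [folklore] -/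
theorem eGradNormSq_comp_add_right (u : UnitAddTorus (Fin 3) → EuclideanSpace ℝ (Fin 3))
    (a : UnitAddTorus (Fin 3)) :
    Torus.eGradNormSq (fun y => u (y + a)) = Torus.eGradNormSq u := by
  rw [Torus.eGradNormSq_eq_tsum, Torus.eGradNormSq_eq_tsum]
  simp_rw [mFourierCoeff_complexify_comp_add_right, enorm_smul]
  have h1 : ∀ k : Fin 3 → ℤ, ‖(UnitAddTorus.mFourier k a : ℂ)‖ₑ = 1 := fun k => by
    rw [← ofReal_norm]
    simp [UnitAddTorus.mFourier]
  simp_rw [h1, one_mul]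

/-! ## Pairings against translates -/

/-- **Change of variables in the `L²` pairing**: `∫ ⟪u(x + a), g x⟫ = ∫ ⟪u x, g(x - a)⟫`. [folklore] -/
theorem integral_inner_comp_add_right (u g : UnitAddTorus (Fin 3) → EuclideanSpace ℝ (Fin 3))
    (a : UnitAddTorus (Fin 3)) :
    ∫ x, ⟪u (x + a), g x⟫_ℝ = ∫ x, ⟪u x, g (x - a)⟫_ℝ := by
  have h := integral_add_right_eq_self (μ := (volume : Measure (UnitAddTorus (Fin 3))))
    (fun x => ⟪u x, g (x - a)⟫_ℝ) a
  simp only [add_sub_cancel_right] at h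
  exact h

/-- **Change of variables in the inertial integrand**:
`∫ ⟪Dg(x) u(x + a), u(x + a)⟫ = ∫ ⟪D(g(· - a))(x) u x, u x⟫`. [folklore] -/
theorem integral_inner_fderiv_comp_add_right (u g : UnitAddTorus (Fin 3) → EuclideanSpace ℝ (Fin 3))
    (a : UnitAddTorus (Fin 3)) :
    ∫ x, ⟪Torus.fderiv g x (u (x + a)), u (x + a)⟫_ℝ =
      ∫ x, ⟪Torus.fderiv (fun y => g (y - a)) x (u x), u x⟫_ℝ := by
  have h := integral_add_right_eq_self (μ := (volume : Measure (UnitAddTorus (Fin 3))))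
    (fun x => ⟪Torus.fderiv (fun y => g (y - a)) x (u x), u x⟫_ℝ) a
  have h2 : ∀ x, Torus.fderiv (fun y => g (y - a)) (x + a) = Torus.fderiv g x := fun x => by
    rw [← fderiv_comp_add_right (fun y => g (y - a)) a x, comp_sub_right_comp_add_right]
  simp only [h2] at h
  exact h

/-- **A shear-invariant field pairs equally with a test field and its shear translate**:
if `f(x + a) = f x` for all `x` then `∫ ⟪f, g(· - a)⟫ = ∫ ⟪f, g⟫`. [folklore] -/
theorem integral_inner_comp_sub_right_of_invariant {f : UnitAddTorus (Fin 3) → EuclideanSpace ℝ (Fin 3)}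
    {a : UnitAddTorus (Fin 3)} (hf : ∀ x, f (x + a) = f x)
    (g : UnitAddTorus (Fin 3) → EuclideanSpace ℝ (Fin 3)) :
    ∫ x, ⟪f x, g (x - a)⟫_ℝ = ∫ x, ⟪f x, g x⟫_ℝ := by
  have h := integral_inner_comp_add_right f g a
  simp only [hf] at h
  exact h.symm

end

/-! ## Shear-invariant trigonometric polynomials -/

/-- A character `e_k` with `k = (0, k₁, 0)` is trivial on the shear group `{a | a 1 = 0}`. [folklore] -/
theorem mFourier_apply_eq_one_of_axial {k : Fin 3 → ℤ} (hk0 : k 0 = 0) (hk2 : k 2 = 0)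
    {a : UnitAddTorus (Fin 3)} (ha : a 1 = 0) : (UnitAddTorus.mFourier k a : ℂ) = 1 := by
  have h : ∀ i : Fin 3, k i • a i = 0 := fun i => by
    fin_cases i
    · simp [hk0]
    · simp [ha]
    · simp [hk2]
  simp [UnitAddTorus.mFourier, h]

/-- **A real trigonometric polynomial carried by axial frequencies `(0, k₁, 0)` is invariant under
the shear group** `{a | a 1 = 0}` (it depends on `x₁` only). [folklore] -/
theorem realTrigPoly_comp_add_right_of_axial {S : Finset (Fin 3 → ℤ)} (hS : ∀ k ∈ S, k 0 = 0 ∧ k 2 = 0)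
    (c : (Fin 3 → ℤ) → EuclideanSpace ℂ (Fin 3)) {a : UnitAddTorus (Fin 3)} (ha : a 1 = 0) (x : UnitAddTorus (Fin 3)) :
    Torus.realTrigPoly S c (x + a) = Torus.realTrigPoly S c x := by
  simp only [Torus.realTrigPoly_apply, Torus.trigPoly_apply]
  congr 1
  refine Finset.sum_congr rfl fun k hk => ?_
  rw [Torus.mFourier_apply_add, mFourier_apply_eq_one_of_axial (hS k hk).1 (hS k hk).2 ha, mul_one]

/-- **Registered sub-goal `designSymShift_curl_comp_add_right` of stub S6′** (summary of this file's
translation calculus): translations commute with the curl. [folklore] -/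
theorem designSymShift_curl_comp_add_right : ∀ (g : UnitAddTorus (Fin 3) → EuclideanSpace ℝ (Fin 3)) (a x : UnitAddTorus (Fin 3)), BDSV.curl (fun y => g (y + a)) x = BDSV.curl g (x + a) :=
  fun g a x => curl_comp_add_right g a x

end Summit.AnomalousDissipation.AnomalousDissipation.Theorems.MomentParityQuarticGate
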